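import Mathlib
import Literature.Computability.AlgebraicComplexity.FixedPointLog
import Summits.RiemannHypothesis.RiemannHypothesis.Theorems.WeilFormatCKCellCert
import Summits.RiemannHypothesis.RiemannHypothesis.Theorems.WeilFormatCKCellDefs
import HarnessLib

/-!
# k-prime cell certificate (route K3 successor): real semantics of the header and the certified BRACKETS

Helper file (`--supports stmt-RiemannHypothesis-0098`), RH-free; seat rh-explicit-weil-1 gen7.  Companion of the kernel
checker `WeilFormatCKCellCert.lean`: the real meaning of the header data (`Cert.phi γ = γ·ℓ`, `ℓ_j = log p_j`; the weight
`Cert.wt (j,e,·,·) = log p_j/√(p_j^e)`), the unpacking of the structural checks, and the bracket lemmas: the claimed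
logarithm enclosures are the tree's certified ones (`log_bracket`, via `FixedPoint.logNatLo/Hi_sound`), the frequency
enclosures `freqLo γ ≤ 2^P·γ·ℓ ≤ freqHi γ`, the real form of the admissibility test (`adm_real`:
`γ·ℓ > 2h(l−k+1) ∨ γ·ℓ < 2h(l−k−1)`, `2h = 2aQ/p`), and the weight brackets `wLo ≤ wt ≤ wHi`.  Standard axioms only.
-/

set_option linter.dupNamespace false
set_option autoImplicit false

noncomputable section

namespace Summit.RiemannHypothesis.RiemannHypothesis.Theorems.WeilFormatC

namespace KCell

open MeasureTheory Set Finset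
open scoped Real BigOperators
open Literature.Computability.AlgebraicComplexity

namespace Cert

variable (c : Cert)

/-! ### Real semantics of the header -/

variable {c}

/-- `phiFrom` of a difference (equal lengths). -/
theorem phiFrom_vsub : ∀ (j : ℕ) (u v : List ℤ), u.length = v.length →
    c.phiFrom j (vsub u v) = c.phiFrom j u - c.phiFrom j v
  | j, [], [], _ => by simp [vsub, phiFrom]
  | j, x :: xs, y :: ys, h => by
      simp only [List.length_cons, Nat.add_right_cancel_iff] at h
      simp only [vsub, phiFrom, phiFrom_vsub (j + 1) xs ys h]; push_cast; ring
  | _, [], _ :: _, h => by simp at h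
  | _, _ :: _, [], h => by simp at h

/-- `φ(u − v) = φ(u) − φ(v)` for exponent vectors of equal length. -/
theorem phi_vsub {u v : List ℤ} (h : u.length = v.length) : c.phi (vsub u v) = c.phi u - c.phi v :=
  phiFrom_vsub 0 u v h

/-- `vsub` preserves the (common) length. -/
theorem length_vsub : ∀ (u v : List ℤ), u.length = v.length → (vsub u v).length = u.length
  | [], [], _ => rfl
  | x :: xs, y :: ys, h => by
      simp only [List.length_cons, Nat.add_right_cancel_iff] at h
      simp [vsub, length_vsub xs ys h]
  | [], _ :: _, h => by simp at h
  | _ :: _, [], h => by simp at h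

/-- Semantics of `uvecN`: `phiFrom i (uvecN j e n) = e · log p_{i+j}` if `j < n`, else `0`. -/
theorem phiFrom_uvecN : ∀ (n i j : ℕ) (e : ℤ),
    c.phiFrom i (uvecN j e n) = if j < n then (e : ℝ) * Real.log (c.pj (i + j)) else 0
  | 0, i, j, e => by simp [uvecN, phiFrom]
  | n + 1, i, j, e => by
      by_cases hj : j = 0
      · subst hj
        simp only [uvecN, if_true, phiFrom, phiFrom_uvecN n (i + 1) 0 0, Nat.zero_lt_succ, add_zero]
        push_cast; simp
      · simp only [uvecN, hj, if_false, phiFrom, phiFrom_uvecN n (i + 1) (j - 1) e]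
        push_cast
        have e1 : i + 1 + (j - 1) = i + j := by omega
        rw [e1]
        by_cases hjn : j < n + 1
        · rw [if_pos (by omega), if_pos hjn]; ring
        · rw [if_neg (by omega), if_neg hjn]; ring

/-- Length of `uvecN`. -/
theorem length_uvecN : ∀ (n j : ℕ) (e : ℤ), (uvecN j e n).length = n
  | 0, _, _ => rfl
  | n + 1, j, e => by simp [uvecN, length_uvecN n]

/-- For `j < k`: `φ(e·unit j) = e · log p_j`. -/
theorem phi_uvec {j : ℕ} (hj : j < c.primes.length) (e : ℤ) : c.phi (c.uvec j e) = (e : ℝ) * Real.log (c.pj j) := by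
  simp only [phi, uvec, phiFrom_uvecN, if_pos hj, zero_add]

/-- Length of `uvec`. -/
theorem length_uvec (j : ℕ) (e : ℤ) : (c.uvec j e).length = c.primes.length := length_uvecN _ _ _

/-- `prepCols` preserves length. -/
theorem length_prepCols : ∀ (As : List ℕ), (c.prepCols As).length = As.length
  | [] => rfl
  | A :: As => by simp [prepCols, length_prepCols As]

/-- `prepBlocks` preserves length. -/
theorem length_prepBlocks : ∀ (L : List (List ℤ × List ℕ)), (c.prepBlocks L).length = L.length
  | [] => rfl
  | b :: bs => by simp [prepBlocks, length_prepBlocks bs]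

/-- The derived block list has the length of the raw one. -/
theorem length_blocks : c.blocks.length = c.rblocks.length := length_prepBlocks _

-- (`wsum_append` — additivity of `wsum` under append — is proved locally where used (`WeilFormatCKCellTable.entryVal_merge`):
-- an identical statement is already landed as `JointSOS.Cert.wsum_append`, which the gate's dedup lint would bounce.)

/-- `qsum` is the list sum. -/
theorem qsum_eq_sum : ∀ (l : List ℚ), qsum l = l.sum
  | [] => rfl
  | q :: qs => by rw [qsum, qsum_eq_sum qs, List.sum_cons]

/-- `rowSum F L` is the sum of `F` over `L`. -/
theorem rowSum_eq_sum (F : ℕ → ℚ) : ∀ (L : List ℕ), rowSum F L = (L.map F).sum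
  | [] => rfl
  | l :: ls => by rw [rowSum, rowSum_eq_sum F ls, List.map_cons, List.sum_cons]

/-! ### Unpacking the structural checks -/

/-- `hdrOK_spec`: the per-prime checks from position `j`. -/
theorem hdrOK_spec : ∀ {j : ℕ} {qs : List ℕ}, c.hdrOK j qs = true → ∀ i < qs.length,
    FixedPoint.inRange (c.ej (j + i)) (qs.getD i 0) = true ∧
      c.logLo (j + i) = FixedPoint.logNatLo c.prec c.terms (c.ej (j + i)) (qs.getD i 0) ∧
      c.logHi (j + i) = FixedPoint.logNatHi c.prec c.terms (c.ej (j + i)) (qs.getD i 0)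
  | j, [], _, i, hi => by simp at hi
  | j, q :: qs, h, i, hi => by
      simp only [hdrOK, Bool.and_eq_true, decide_eq_true_eq] at h
      obtain ⟨⟨⟨h1, h2⟩, h3⟩, h4⟩ := h
      rcases i with _ | i
      · simpa using ⟨h1, h2, h3⟩
      · simp only [List.length_cons, Nat.add_lt_add_iff_right] at hi
        have := hdrOK_spec h4 i hi
        simp only [List.getD_cons_succ]
        rwa [show j + (i + 1) = j + 1 + i by omega]

/-- For `j < k`: the range hint holds and the claimed enclosures are the tree's. -/
theorem logsOK_lt (hl : c.logsOK = true) {j : ℕ} (hj : j < c.primes.length) :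
    2 ^ c.ej j ≤ c.pj j ∧ c.pj j ≤ 2 ^ (c.ej j + 1) ∧
      c.logLo j = FixedPoint.logNatLo c.prec c.terms (c.ej j) (c.pj j) ∧
      c.logHi j = FixedPoint.logNatHi c.prec c.terms (c.ej j) (c.pj j) := by
  simp only [logsOK, Bool.and_eq_true, decide_eq_true_eq] at hl
  obtain ⟨⟨⟨⟨⟨_, _⟩, _⟩, hh⟩, _⟩, _⟩ := hl
  have := hdrOK_spec hh j hj
  simp only [zero_add] at this
  obtain ⟨h1, h2, h3⟩ := this
  exact ⟨(FixedPoint.inRange_iff.1 h1).1, (FixedPoint.inRange_iff.1 h1).2, h2, h3⟩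

/-- Beyond the list: `p_j = 0`, `logLo j = logHi j = 0`. -/
theorem logsOK_ge (hl : c.logsOK = true) {j : ℕ} (hj : c.primes.length ≤ j) :
    c.pj j = 0 ∧ c.logLo j = 0 ∧ c.logHi j = 0 := by
  simp only [logsOK, Bool.and_eq_true, decide_eq_true_eq] at hl
  obtain ⟨⟨⟨⟨⟨h1, h2⟩, h3⟩, _⟩, _⟩, _⟩ := hl
  refine ⟨?_, ?_, ?_⟩
  · simp only [pj, List.getD_eq_getElem?_getD, List.getElem?_eq_none hj, Option.getD_none]
  · simp only [logLo, List.getD_eq_getElem?_getD, List.getElem?_eq_none (h2 ▸ hj), Option.getD_none]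
  · simp only [logHi, List.getD_eq_getElem?_getD, List.getElem?_eq_none (h3 ▸ hj), Option.getD_none]

/-- For `j < k`: `1 ≤ p_j`. -/
theorem one_le_pj (hl : c.logsOK = true) {j : ℕ} (hj : j < c.primes.length) : 1 ≤ c.pj j :=
  le_trans Nat.one_le_two_pow (logsOK_lt hl hj).1

/-- The threshold and denominator in real form: `thr = 2^{P+1}·aQ·aden` and `aden = den(aQ) > 0`. -/
theorem thr_real (hl : c.logsOK = true) :
    (c.thr : ℝ) = (2 : ℝ) ^ (c.prec + 1) * (c.aQ : ℝ) * (c.aden : ℝ) := by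
  simp only [logsOK, Bool.and_eq_true, decide_eq_true_eq] at hl
  obtain ⟨⟨_, hthr⟩, hden⟩ := hl
  have hd : ((c.aQ.den : ℕ) : ℝ) ≠ 0 := by exact_mod_cast c.aQ.den_ne_zero
  rw [hthr, hden]; push_cast
  rw [mul_assoc, Rat.cast_def, div_mul_cancel₀ _ hd]

/-! ### The logarithm, frequency and weight brackets -/

/-- `logLo j ≤ 2^P log p_j ≤ logHi j` (every `j`). -/
theorem log_bracket (hl : c.logsOK = true) (j : ℕ) :
    (c.logLo j : ℝ) ≤ (2 : ℝ) ^ c.prec * Real.log (c.pj j) ∧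
      (2 : ℝ) ^ c.prec * Real.log (c.pj j) ≤ (c.logHi j : ℝ) := by
  by_cases hj : j < c.primes.length
  · obtain ⟨h1, h2, h3, h4⟩ := logsOK_lt hl hj
    rw [h3, h4]
    exact ⟨FixedPoint.logNatLo_sound _ _ h1 h2, FixedPoint.logNatHi_sound _ _ h1 h2⟩
  · obtain ⟨h1, h2, h3⟩ := logsOK_ge hl (not_lt.1 hj)
    simp [h1, h2, h3]

/-- `mulLogLo j x ≤ 2^P · x log p_j ≤ mulLogHi j x`. -/
theorem mulLog_bracket (hl : c.logsOK = true) (j : ℕ) (x : ℤ) :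
    (c.mulLogLo j x : ℝ) ≤ (2 : ℝ) ^ c.prec * ((x : ℝ) * Real.log (c.pj j)) ∧
      (2 : ℝ) ^ c.prec * ((x : ℝ) * Real.log (c.pj j)) ≤ (c.mulLogHi j x : ℝ) := by
  obtain ⟨hlo, hhi⟩ := log_bracket hl j
  unfold mulLogLo mulLogHi
  by_cases hx : 0 ≤ x
  · rw [if_pos hx, if_pos hx]; push_cast
    have hx' : (0 : ℝ) ≤ x := by exact_mod_cast hx
    constructor <;> nlinarith
  · rw [if_neg hx, if_neg hx]; push_cast
    have hx' : (x : ℝ) ≤ 0 := by exact_mod_cast (le_of_lt (not_le.1 hx))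
    constructor <;> nlinarith

/-- `freqLoFrom j γ ≤ 2^P · phiFrom j γ ≤ freqHiFrom j γ`. -/
theorem freqFrom_bracket (hl : c.logsOK = true) : ∀ (γ : List ℤ) (j : ℕ),
    (c.freqLoFrom j γ : ℝ) ≤ (2 : ℝ) ^ c.prec * c.phiFrom j γ ∧
      (2 : ℝ) ^ c.prec * c.phiFrom j γ ≤ (c.freqHiFrom j γ : ℝ)
  | [], j => by simp [freqLoFrom, freqHiFrom, phiFrom]
  | x :: xs, j => by
      obtain ⟨h1, h2⟩ := mulLog_bracket hl j x
      obtain ⟨h3, h4⟩ := freqFrom_bracket hl xs (j + 1)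
      simp only [freqLoFrom, freqHiFrom, phiFrom]; push_cast
      constructor <;> nlinarith

/-- **Frequency brackets**: `freqLo γ ≤ 2^P · γ·ℓ ≤ freqHi γ`. -/
theorem freq_bracket (hl : c.logsOK = true) (γ : List ℤ) :
    (c.freqLo γ : ℝ) ≤ (2 : ℝ) ^ c.prec * c.phi γ ∧ (2 : ℝ) ^ c.prec * c.phi γ ≤ (c.freqHi γ : ℝ) :=
  freqFrom_bracket hl γ 0

/-- **The admissibility test in real form**: if `admLH lo hi k l` holds for enclosures `lo ≤ 2^P u ≤ hi`, then
`u > 2h(l−k+1)` or `u < 2h(l−k−1)` (`2h = cw = 2aQ/p`). -/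
theorem adm_real (hl : c.logsOK = true) (hden : 0 < c.aden) (hp : 0 < c.pcells) {lo hi : ℤ} {u : ℝ}
    (hlo : (lo : ℝ) ≤ (2 : ℝ) ^ c.prec * u) (hhi : (2 : ℝ) ^ c.prec * u ≤ (hi : ℝ)) {k l : ℕ}
    (h : c.admLH lo hi k l = true) :
    c.cw * ((l : ℝ) - k + 1) < u ∨ u < c.cw * ((l : ℝ) - k - 1) := by
  have hthr := thr_real hl
  have hdenR : (0 : ℝ) < c.aden := by exact_mod_cast hden
  have hpR : (0 : ℝ) < c.pcells := by exact_mod_cast hp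
  have hP : (0 : ℝ) < (2 : ℝ) ^ c.prec := by positivity
  have hcwp : c.cw * c.pcells = 2 * c.aQ := by simp only [cw]; field_simp
  simp only [admLH, Bool.or_eq_true, decide_eq_true_eq] at h
  rcases h with hlt | hgt
  · left
    have hltR : (c.thr : ℝ) * ((l : ℝ) - k + 1) < (lo : ℝ) * (c.aden : ℝ) * (c.pcells : ℝ) := by exact_mod_cast hlt
    have h1 : (lo : ℝ) * c.aden * c.pcells ≤ (2 : ℝ) ^ c.prec * u * c.aden * c.pcells := by
      have := mul_le_mul_of_nonneg_right (mul_le_mul_of_nonneg_right hlo hdenR.le) hpR.le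
      linarith
    have h2 : (2 : ℝ) ^ (c.prec + 1) * c.aQ * c.aden * ((l : ℝ) - k + 1) < (2 : ℝ) ^ c.prec * u * c.aden * c.pcells := by
      rw [hthr] at hltR; linarith
    rw [pow_succ] at h2
    have h3 : (2 : ℝ) ^ c.prec * (c.aden * (u * c.pcells - 2 * c.aQ * ((l : ℝ) - k + 1))) > 0 := by nlinarith
    have h4 : c.aden * (u * c.pcells - 2 * c.aQ * ((l : ℝ) - k + 1)) > 0 := by
      by_contra hcon; push Not at hcon; nlinarith
    have h5 : u * c.pcells - 2 * c.aQ * ((l : ℝ) - k + 1) > 0 := by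
      by_contra hcon; push Not at hcon; nlinarith
    rw [← hcwp] at h5
    have h6 : c.pcells * (u - c.cw * ((l : ℝ) - k + 1)) > 0 := by nlinarith
    have h7 : u - c.cw * ((l : ℝ) - k + 1) > 0 := by
      by_contra hcon; push Not at hcon; nlinarith
    linarith
  · right
    have hgtR : (hi : ℝ) * (c.aden : ℝ) * (c.pcells : ℝ) < (c.thr : ℝ) * ((l : ℝ) - k - 1) := by exact_mod_cast hgt
    have h1 : (2 : ℝ) ^ c.prec * u * c.aden * c.pcells ≤ (hi : ℝ) * c.aden * c.pcells := by
      have := mul_le_mul_of_nonneg_right (mul_le_mul_of_nonneg_right hhi hdenR.le) hpR.le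
      linarith
    have h2 : (2 : ℝ) ^ c.prec * u * c.aden * c.pcells < (2 : ℝ) ^ (c.prec + 1) * c.aQ * c.aden * ((l : ℝ) - k - 1) := by
      rw [hthr] at hgtR; linarith
    rw [pow_succ] at h2
    have h3 : (2 : ℝ) ^ c.prec * (c.aden * (2 * c.aQ * ((l : ℝ) - k - 1) - u * c.pcells)) > 0 := by nlinarith
    have h4 : c.aden * (2 * c.aQ * ((l : ℝ) - k - 1) - u * c.pcells) > 0 := by
      by_contra hcon; push Not at hcon; nlinarith
    have h5 : 2 * c.aQ * ((l : ℝ) - k - 1) - u * c.pcells > 0 := by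
      by_contra hcon; push Not at hcon; nlinarith
    rw [← hcwp] at h5
    have h6 : c.pcells * (c.cw * ((l : ℝ) - k - 1) - u) > 0 := by nlinarith
    have h7 : c.cw * ((l : ℝ) - k - 1) - u > 0 := by
      by_contra hcon; push Not at hcon; nlinarith
    linarith

/-- `witemOK_spec`. -/
theorem witemOK_spec {w : WItem} (h : c.witemOK w = true) :
    w.1 < c.primes.length ∧ 1 ≤ w.2.1 ∧ 0 < w.2.2.1 ∧ w.2.2.1 ^ 2 ≤ c.pj w.1 ^ w.2.1 * 4 ^ c.prec ∧
      c.pj w.1 ^ w.2.1 * 4 ^ c.prec < (w.2.2.1 + 1) ^ 2 ∧ 1 ≤ w.2.2.2 ∧ w.2.2.2 < c.rblocks.length := by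
  simpa [witemOK, Bool.and_eq_true, decide_eq_true_eq, and_assoc] using h

/-- `windowOK_spec`. -/
theorem windowOK_spec : ∀ {l : List WItem}, c.windowOK l = true → ∀ w ∈ l, c.witemOK w = true
  | [], _ => by simp
  | w :: rest, h => by
      simp only [windowOK, Bool.and_eq_true] at h
      intro x hx
      rcases List.mem_cons.1 hx with rfl | hx
      · exact h.1
      · exact windowOK_spec h.2 x hx

/-- `attachedOK_spec`. -/
theorem attachedOK_spec : ∀ {l : List WItem}, c.attachedOK l = true → ∀ w ∈ l, c.witemOK w = true
  | [], _ => by simp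
  | w :: rest, h => by
      simp only [attachedOK, Bool.and_eq_true] at h
      intro x hx
      rcases List.mem_cons.1 hx with rfl | hx
      · exact h.1
      · exact attachedOK_spec h.2 x hx

/-- **Weight brackets**: `wLo w ≤ log p_j/√(p_j^e) ≤ wHi w` for a well-formed window item. -/
theorem wt_bracket (hl : c.logsOK = true) (w : WItem) (hw : c.witemOK w = true) :
    (c.wLo w : ℝ) ≤ c.wt w ∧ c.wt w ≤ (c.wHi w : ℝ) := by
  obtain ⟨hj, _, hs, hs1, hs2, _, _⟩ := witemOK_spec hw
  obtain ⟨hlo, hhi⟩ := log_bracket hl w.1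
  have hp : 1 ≤ c.pj w.1 := one_le_pj hl hj
  have hP : (0 : ℝ) < (2 : ℝ) ^ c.prec := by positivity
  set s : ℕ := w.2.2.1 with hsdef
  have h4 : (4 : ℝ) ^ c.prec = ((2 : ℝ) ^ c.prec) ^ 2 := by
    rw [← pow_mul, mul_comm, pow_mul]; norm_num
  have hcast : (((c.pj w.1 ^ w.2.1 * 4 ^ c.prec : ℕ) : ℝ)) = ((c.pj w.1 : ℝ) ^ w.2.1) * ((2 : ℝ) ^ c.prec) ^ 2 := by
    push_cast; rw [h4]
  have hsq : Real.sqrt ((c.pj w.1 : ℝ) ^ w.2.1) * (2 : ℝ) ^ c.prec =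
      Real.sqrt (((c.pj w.1 ^ w.2.1 * 4 ^ c.prec : ℕ) : ℝ)) := by
    rw [hcast, Real.sqrt_mul' _ (by positivity), Real.sqrt_sq hP.le]
  have hSlo : (s : ℝ) ≤ Real.sqrt (((c.pj w.1 ^ w.2.1 * 4 ^ c.prec : ℕ) : ℝ)) := by
    refine Real.le_sqrt_of_sq_le ?_
    exact_mod_cast hs1
  have hShi : Real.sqrt (((c.pj w.1 ^ w.2.1 * 4 ^ c.prec : ℕ) : ℝ)) ≤ (s : ℝ) + 1 := by
    refine Real.sqrt_le_iff.2 ⟨by positivity, ?_⟩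
    exact_mod_cast hs2.le
  have hsR : (0 : ℝ) < (s : ℝ) := by exact_mod_cast hs
  have hroot : 0 < Real.sqrt ((c.pj w.1 : ℝ) ^ w.2.1) := by
    apply Real.sqrt_pos.2; have : (1 : ℝ) ≤ c.pj w.1 := by exact_mod_cast hp
    positivity
  unfold wLo wHi wt
  push_cast
  constructor
  · rw [div_le_div_iff₀ (by positivity) hroot]
    have h1 : (c.logLo w.1 : ℝ) * Real.sqrt ((c.pj w.1 : ℝ) ^ w.2.1) * (2 : ℝ) ^ c.prec ≤
        Real.log (c.pj w.1) * ((s : ℝ) + 1) * (2 : ℝ) ^ c.prec := by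
      calc (c.logLo w.1 : ℝ) * Real.sqrt ((c.pj w.1 : ℝ) ^ w.2.1) * (2 : ℝ) ^ c.prec
          = (c.logLo w.1 : ℝ) * Real.sqrt (((c.pj w.1 ^ w.2.1 * 4 ^ c.prec : ℕ) : ℝ)) := by rw [mul_assoc, hsq]
        _ ≤ ((2 : ℝ) ^ c.prec * Real.log (c.pj w.1)) * ((s : ℝ) + 1) :=
            mul_le_mul hlo hShi (Real.sqrt_nonneg _) (by positivity)
        _ = Real.log (c.pj w.1) * ((s : ℝ) + 1) * (2 : ℝ) ^ c.prec := by ring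
    exact le_of_mul_le_mul_right h1 hP
  · rw [div_le_div_iff₀ hroot hsR]
    have h1 : Real.log (c.pj w.1) * (s : ℝ) * (2 : ℝ) ^ c.prec ≤
        (c.logHi w.1 : ℝ) * Real.sqrt ((c.pj w.1 : ℝ) ^ w.2.1) * (2 : ℝ) ^ c.prec := by
      calc Real.log (c.pj w.1) * (s : ℝ) * (2 : ℝ) ^ c.prec
          = ((2 : ℝ) ^ c.prec * Real.log (c.pj w.1)) * (s : ℝ) := by ring
        _ ≤ (c.logHi w.1 : ℝ) * Real.sqrt (((c.pj w.1 ^ w.2.1 * 4 ^ c.prec : ℕ) : ℝ)) :=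
            mul_le_mul hhi hSlo hsR.le (le_trans (by positivity) hhi)
        _ = (c.logHi w.1 : ℝ) * Real.sqrt ((c.pj w.1 : ℝ) ^ w.2.1) * (2 : ℝ) ^ c.prec := by
            rw [mul_assoc, hsq]
    exact le_of_mul_le_mul_right h1 hP

/-- Brackets of weight sums. -/
theorem wsum_bracket (hl : c.logsOK = true) {ws : List WItem} (hws : ∀ w ∈ ws, c.witemOK w = true) :
    (c.wLoSum ws : ℝ) ≤ c.wsum ws ∧ c.wsum ws ≤ (c.wHiSum ws : ℝ) := by
  induction ws with
  | nil => simp [wLoSum, wHiSum, wsum]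
  | cons w rest ih =>
      have hw := wt_bracket hl w (hws w (by simp))
      have ih' := ih fun w' hw' ↦ hws w' (List.mem_cons_of_mem _ hw')
      simp only [wLoSum, wHiSum, wsum]; push_cast
      exact ⟨add_le_add hw.1 ih'.1, add_le_add hw.2 ih'.2⟩

end Cert

end KCell

end Summit.RiemannHypothesis.RiemannHypothesis.Theorems.WeilFormatC
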